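import Summits.BirchSwinnertonDyer.BirchSwinnertonDyer.Theorems.SchneiderFreeAdditiveX3PotMultReadHyps
import HarnessLib
import HarnessLib.Audit.Tags

/-!
# Route `SchneiderFreeAdditiveX3` (K1 door), crux `PotMultBranchIMC` (stmt-BirchSwinnertonDyer-19176):
# the (M) research input ORIENTED — `PotMultRead.KYCHMOriented` (repair of `KYCHM` / `hKYCH` of p487100)

Cell `bsd-schneider-ideate` (HOME `run/shared/lean/pub/bsd-schneider-ideate/`), seat `door-c2` gen 9.
PARTITION: board row B6 ∩ X3 ∩ sst-twist, `r = 1`, (M) half (4 541 of 7 101 pairs) of `Rank1Residual.partition`;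
types-the-object-of the ONE research stub of the (M) line «rebased-M» in its honest (weaker) form; closes nothing
(BSD is not advanced; the crux stays OPEN). Theses-free.

WHY. `PotMultRead.KYCHM` (p490996) = door-c2 gen 8's `hKYCH` (p487100) verbatim asks, at each frame, for ONE pair
`(L, u)` whose value clause holds for EVERY `β : ℤ` and every `y ∈ V(K[p])` over the complex point
`heegnerPointComplexOfConductor Dt_V d_K β p`. For an ORIENTATION `β` (`4 N_V ∣ β² − d_K`) these are the honest
conductor-`p` Heegner points of the partner and the descended twisted points `Q_β ∈ W(K)` all have the same canonical
height (Cai–Shu–Tian Thm 1.5) in the rank-one group `W(K)`, hence the same `(log_ω Q)²` — one `u` serves all. For a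
NON-orientation `β` the tree's total function `heegnerPointOfConductor d_K β p` is a CM point of the junk discriminant
`p²(d_K + 3)` (even `β`, odd `d_K`), i.e. of ANOTHER imaginary quadratic order; whenever such a point happens to lift to
`V(K[p])` its `χ_ε`-twisted trace descends to a point `Q` unrelated to the Heegner point (e.g. torsion, forcing
`L(0) = 0` against the divisibility clause and CTL₀). So `KYCHM` is STRONGER than the mathematics it names, by an
uncontrolled statement about junk CM points. `KYCHMOriented` inserts the single hypothesis
`4 * N_V ∣ β ^ 2 - d_K` — exactly what the (M) road uses (p487100 / p492424 instantiate `β` from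
`Quadratic.exists_dvd_sq_sub_discr_of_split_or_dvd`, which carries it). The repair is a WEAKENING
(`KYCHM → KYCHMOriented`, immediate); the sibling `…PotMultBranchIMCOfKYCHMOriented.lean` re-proves the crux from it, and skeleton
«rebased-M» v3 re-types `stub_KYCH_M : KYCHMOriented` (verdict on the v1/v2 stub: misstated — over-strong off the
orientations; repaired here).

Statement only — one predicate WITH BODY (conjecture-tagged obligation node, nothing asserted).
References: Gross, LMS LNS 153 (1991) §3 (Heegner points of conductor n, orientations `β mod 2N`); Darmon 2004 Thm. 3.6;
Cai–Shu–Tian, ANT 8 (2014) Thm. 1.5; Keller–Yin arXiv:2410.23241 §3.4–3.5, p. 15 (shape; preprint);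
Castella–Hsieh, Math. Ann. 370 (2018) Thm. 5.7 (shape of the value formula at `p ∤ N`).
-/

noncomputable section

open scoped Classical

open WeierstrassCurve NumberField IsDedekindDomain Field
  Literature.NumberTheory.EllipticCurves
  Literature.NumberTheory.EllipticCurves.CaiShuTian2014
  Literature.NumberTheory.EllipticCurves.ModularForms
  Literature.NumberTheory.EllipticCurves.GreenbergSelmer
  Literature.NumberTheory.EllipticCurves.Rank1Residual
  Literature.NumberTheory.GaloisRepresentations
  Literature.NumberTheory.GaloisCohomology
  Summit.BirchSwinnertonDyer.Rank1Residual
  Summit.BirchSwinnertonDyer.Rank1Residual.X11b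
  Summit.BirchSwinnertonDyer.Rank1Residual.X11b.AcSelmer
  Summit.BirchSwinnertonDyer.Rank1Residual.X11b.Halves

-- D-0017 layout: summit = sub-problem, so `Summit.BirchSwinnertonDyer.BirchSwinnertonDyer.…` is the
-- mandated namespace (same option as the route's sockets files).
set_option linter.dupNamespace false
set_option autoImplicit false

namespace Summit.BirchSwinnertonDyer.BirchSwinnertonDyer.Theorems.SchneiderFree.PotMultRead

/-- **`KYCHMOriented` — the ONE frame-level input of the (M) line, ORIENTED** (`KYCHM` with the value clause
restricted to orientations `β`, `4 N_V ∣ β² − d_K`, i.e. to the honest conductor-`p` Heegner points of the partner).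
At every presented socket datum of a door curve `W = C₂ • ((D • V) ⊗ χ_{p*})` on the (M) cell and every anticyclotomic
frame `(κ, γ, 𝔭)` with `𝔭 ∣ p` of degree one, for every parametrisation datum `DtV` of the partner: a series
`L ∈ R₀⟦T⟧` and `u ∈ R₀` with (h3|M) `Ch_Λ(X_ac^∅(W_K))·R₀⟦T⟧ ⊆ (L)` and (h2|M) `L(0) = u·(log_ω Q / c_V)²` at the
descended `χ_ε`-twisted conductor-`p` Heegner point `Q ∈ W(K)` built from ANY orientation `β`, the `K[p]`-point `y`
over `y_β(p)`, and any genus datum `θ`, `s`. RESEARCH — the branch main conjecture ⊇ for the multiplicative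
Eisenstein partner on the `χ_ε`-branch and the conductor-`p` `p`-adic value formula at `p ∥ N_V`, neither in print;
a predicate, conjecture-tagged, nothing asserted.
[cite: KellerYin2024b, §3.4–3.5 and p. 15 (arXiv:2410.23241) (shape; preprint; names the case open)]
[cite: CastellaHsieh2018, Thm. 5.7 and Lemma 5.4 (shape of the value formula at p ∤ N)]
[cite: GrossLMS1991, §3 (Heegner points of conductor n and their orientations)] -/
@[conjecture]
def KYCHMOriented : Prop :=
  ∀ (p : ℕ) [Fact p.Prime] (V : WeierstrassCurve ℚ) [V.IsElliptic] [V.IsGloballyMinimal]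
      [NeZero (V.conductorNorm ℤ)] (D C₂ : VariableChange ℚ) [(D • V).IsCharNeTwoNF]
      [(C₂ • (D • V).quadraticTwist ((-1 : ℚ) ^ (p / 2) * p)).IsElliptic]
      [(C₂ • (D • V).quadraticTwist ((-1 : ℚ) ^ (p / 2) * p)).IsGloballyMinimal]
      (N : ℕ) [NeZero N] (K : Type) [Field K] [NumberField K]
      (Dt : ModularParametrizationData (C₂ • (D • V).quadraticTwist ((-1 : ℚ) ^ (p / 2) * p)) N)
      (H : HeegnerDatum N (NumberField.discr K)) (ι : K →+* ℂ)
      (P : ((C₂ • (D • V).quadraticTwist ((-1 : ℚ) ^ (p / 2) * p)).baseChange K).toAffine.Point),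
      (C₂ • (D • V).quadraticTwist ((-1 : ℚ) ^ (p / 2) * p)).analyticRank = 1 →
      Additive.N10.Locus (C₂ • (D • V).quadraticTwist ((-1 : ℚ) ^ (p / 2) * p)) p →
      (C₂ • (D • V).quadraticTwist ((-1 : ℚ) ^ (p / 2) * p)).conductorNorm ℤ = N →
      IsImaginaryQuadratic K → Odd (NumberField.discr K) → ¬ p ∣ Units.torsionOrder K →
      SatisfiesHeegnerHypothesis N K →
      ((C₂ • (D • V).quadraticTwist ((-1 : ℚ) ^ (p / 2) * p)).quadraticTwist
        (NumberField.discr K : ℚ)).entireLFunction 1 ≠ 0 →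
      WeierstrassCurve.Affine.Point.map ι.toRatAlgHom P = heegnerPointComplex Dt H →
      ¬ IsOfFinAddOrder P → p ≠ 2 → Mult V p →
      ∀ (κ : ZpExtension K p), κ.IsAnticyclotomic →
      ∀ (γ : Field.absoluteGaloisGroup K) [Fact (κ.IsTopGenerator γ)]
        (𝔭 : HeightOneSpectrum (𝓞 K)) (h𝔭 : ((p : ℕ) : 𝓞 K) ∈ 𝔭.asIdeal)
        (he : 𝔭.asIdeal.ramificationIdx (𝓞 ℚ) = 1) (hf : 𝔭.asIdeal.inertiaDeg (𝓞 ℚ) = 1),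
      ∀ [NumberField (ringClassField K ι p)]
        (DtV : ModularParametrizationData V (V.conductorNorm ℤ)),
      ∃ (L : UnrSeries p) (u : unrIntegers p),
        (XAc.charIdeal ((C₂ • (D • V).quadraticTwist ((-1 : ℚ) ^ (p / 2) * p)).baseChange K)
            p κ 𝔭 ∅ γ).map (PowerSeries.map (toUnr p)) ≤ Ideal.span {L} ∧
        ∀ (β : ℤ), 4 * (V.conductorNorm ℤ : ℤ) ∣ β ^ 2 - NumberField.discr K →
        ∀ (y : (V.baseChange (ringClassField K ι p : Type)).toAffine.Point),
          WeierstrassCurve.Affine.Point.map (ringClassField K ι p).subtype.toRatAlgHom y =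
            heegnerPointComplexOfConductor DtV (NumberField.discr K) β p →
          ∀ (θ : ringClassField K ι p)
            (hθ2 : θ ^ 2 = algebraMap ℚ (ringClassField K ι p) ((-1 : ℚ) ^ (p / 2) * p))
            (hθ : θ ≠ 0) (s : ringClassGal ι p → ℤˣ),
          (∀ σ : ringClassGal ι p, σ.1 θ = ((s σ : ℤ) : ringClassField K ι p) * θ) →
          ∀ Q : ((C₂ • (D • V).quadraticTwist ((-1 : ℚ) ^ (p / 2) * p)).baseChange K).toAffine.Point,
          Affine.Point.map (algebraMap K (ringClassField K ι p)).toRatAlgHom Q =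
            VariableChange.pointEquivBaseChange ((D • V).quadraticTwist ((-1 : ℚ) ^ (p / 2) * p)) C₂
              (ringClassField K ι p)
              ((VariableChange.pointEquiv (((D • V).quadraticTwist
                  ((-1 : ℚ) ^ (p / 2) * p)).baseChange (ringClassField K ι p : Type))
                  (untwistAt hθ)).symm
                ((Affine.Point.congrEquiv (untwistAt_smul_eq (D • V) hθ2 hθ)).symm
                  (VariableChange.pointEquivBaseChange V D (ringClassField K ι p)
                    (∑ τ : ringClassGal ι p,
                      (s τ : ℤ) • pointGalHom V (ringClassField K ι p : Type) τ.1 y)))) →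
          L.HasValueAt 0 (((u : unrIntegers p) : ℂ_[p]) *
            (algebraMap ℚ_[p] ℂ_[p] (logOmega (C₂ • (D • V).quadraticTwist ((-1 : ℚ) ^ (p / 2) * p))
              p (embAt K p 𝔭 h𝔭 he hf) Q / (DtV.c : ℚ_[p]))) ^ 2)


-- `KYCHM → KYCHMOriented` is immediate (drop the value clause off the orientations); it is not stated as a
-- theorem here so that no audit reads a conjecture-to-conjecture implication as a proof of `KYCHMOriented`.

end Summit.BirchSwinnertonDyer.BirchSwinnertonDyer.Theorems.SchneiderFree.PotMultRead

end
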